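import Summits.BirchSwinnertonDyer.BirchSwinnertonDyer.Theorems.ClassRecordThreeEulerHalvesAtThreeCartanCorrespondenceCutTight
import Summits.BirchSwinnertonDyer.BirchSwinnertonDyer.Theorems.ClassRecordThreeEulerHalvesAtThreeCartanCorrespondenceCubicSumRegimes
import Summits.BirchSwinnertonDyer.BirchSwinnertonDyer.Theorems.ClassRecordThreeEulerHalvesAtThreeCartanCorrespondenceCubicSumRungs
import Summits.BirchSwinnertonDyer.BirchSwinnertonDyer.Theorems.ClassRecordThreeEulerHalvesAtThreeCartanCorrespondenceCubicSumAxis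
import Summits.BirchSwinnertonDyer.BirchSwinnertonDyer.Theorems.ClassRecordThreeEulerHalvesAtThreeCartanSupplyNormOneSum
import Summits.BirchSwinnertonDyer.BirchSwinnertonDyer.Theorems.ClassRecordThreeEulerHalvesAtThreeCartanSupplyMonomialNet
import Summits.BirchSwinnertonDyer.BirchSwinnertonDyer.Theorems.ClassRecordThreeEulerHalvesAtThreeCartanStubF2bResidue
import Summits.BirchSwinnertonDyer.BirchSwinnertonDyer.Theorems.ClassRecordThreeEulerHalvesAtThreeCartanPSNoFixedVector
import Summits.BirchSwinnertonDyer.BirchSwinnertonDyer.Theorems.ClassRecordThreeEulerHalvesAtThreeCartanSaturatedDictionary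
import Summits.BirchSwinnertonDyer.BirchSwinnertonDyer.Theorems.ClassRecordThreeEulerHalvesAtThreeCartanSatOfNoFixed
import HarnessLib

/-!
# Crux 19109 `EulerHalvesAtThree` — sub-line `cartan_corr` r11 (UNREGISTERED; RULING 91 sub-line one level below the 23422 v9 stub (F2b♭)
# `CartanDegree.CartanHomLatticeDictionaryAtThreeVal`; W-79: never skeleton-checked; the skeleton of record stays `Lines/inert.lean`)

Seat `bsd-idea-10` g12–g15 (r8 ∕ r9: planner-bsd-idea-10-g14-0; r10 ∕ r11: planner-bsd-idea-10-g15-0). r1 (commit d939908b2fdf) was self-contained; r2 (19a32fa804d9) ∕ r3 (df89df13013f) ∕ r4 are THIN WRAPPERS over the seven landed Theorems files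
that now carry the content (all `--supports stmt-BirchSwinnertonDyer-19109 --as helper`):
* `Theorems/ClassRecordThreeEulerHalvesAtThreeCartanCorrespondenceCut.lean` (p686517 ✓ d0790025efa1) — the two-curve correspondence cut:
  (F2b♭) ⟸ S-K1′ ∧ supply ∧ NUM (+ converse); NUM ⟸ S3♭ ∧ COR ∧ U♯ ∧ SIGN; `torusPairSum`; seven closed `@[conjecture]` inputs;
* `…CartanCorrespondenceCutTight.lean` (p687002 ✓ e891b1524095) — NUM_V (the `V`-minimal law); COR ∧ U♯ ⊢ SIGN ⟺ NUM_V; S3♭ ⊢ NUM ⟺ NUM_V;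
* `…CartanCorrespondenceCubicSum.lean` (p687642 ✓ 51f04dacc67f) — CLOSED FORM of U♯ at the principal-series places
  (`S(η) = (q−1)²·|Σ_{x∈𝔽_q^×} θ(Q_η(x,1)/x)|²`), U♯ ⟸ closed form ∧ elementary count law ∧ cuspidal places, and the count law DECIDED for every
  prime `q ≡ 1 (3)` up to `43`;
* `…CartanCorrespondenceCubicSumRegimes.lean` (p689637 ✓ 2a39eb25d647) — EXACT STRUCTURE of the PS cubic sums: PROVED `3 ∣ |Σ_Q|²` for every
  irreducible `Q` (the cubic classes partition `𝔽_q^×`), axis count law ⇒ `|Σ_Q|² = 3n²`, and the regime decomposition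
  `N1♯ (β = 0 family, 2 non-cube) → N2 (sieve, q ≢ 1 (27)) → N3 (residual class R = {q ≡ 1 (27), 2 a cube}: OPEN) → CubicClassCountLawAtThree`;
* `…CartanCorrespondenceCubicSumRungs.lean` (p689735 ✓ 1d88385c509a) — the count law DECIDED for every prime `q ≡ 1 (3)` up to `157`
  (incl. `q = 109 ∈ R`);
* `…CartanCorrespondenceCubicSumAxis.lean` (p690616 ✓ e7a6a774d988) — the AXIS COUNT LAW `CubicAxisCountAtThree` PROVED (involution `t ↦ D/t` on the
  fibration `x ↦ Q(x)/x`; quadratic root counts pair to `2`; `#{t ≠ 0 : (Dt)^e = 1} = e`), hence `CubicSumNormAxisAtThree`: `|Σ_Q|² = 3n²` for EVERY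
  irreducible binary form over `𝔽_q`, `q ≡ 1 (3)`;
* `…CartanCorrespondenceCubicSumRungsResidual.lean` (p691184 ✓ b6e07e1c11fe) — the residual class below `1000` is `{109, 433, 811, 919}` and the count law is
  DECIDED at each: `cubicClassCountLawResidualUpTo1000 : CubicClassCountLawResidualUpTo1000AtThree` PROVED (N3 for every `q < 1000`). NOT imported by this
  wrapper (its kernel `decide`s cost ≈ 150 s of elaboration per build, over the workfile check budget) — cited BY NAME.
* `…CartanSupplyPermModel.lean` (p692372 ✓ 27361c272899; r5) — SUPPLY (`CartanTorusLatticeSupply`, the v11 stub) ⟸ `CartanPermModelSupply` BY NAME: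
  in a PERMUTATION MODEL (χ_W-lattice embedded equivariantly, injectively and purely in `ℤ^S`, `S` a transitive `G`-set with `3 ∤ #S`, coordinate sums `0`)
  the invariant form is the restricted standard form and `(𝓛∕3𝓛)^G = 0` holds AUTOMATICALLY (`noFixedVectorModThree_of_permModel`); the named lattice is the
  pure isotypic sublattice of `ℤ[G∕T]`, `T` the torus of index prime to `3` (`T_s` for `q ≡ 1 (3)`, `T_ns` for `q ≡ 2 (3)`).
* `…CartanSupplyPermSubmodule.lean` (p693435 ✓), `…CartanSupplyIsotypicKernel.lean` (p693853 ✓), `…CartanSupplyCosets.lean` (p696247 ✓ a72bc4822192), `…CartanSupplyCosetsTrace.lean` (p696421 ✓ 260c36f5d42f), `…CartanSupplyTorusLines.lean` (p696985 ✓ 09c01c640b46), `…CartanSupplyConvolution.lean` (p698182 ✓ ca949476411a), `…CartanSupplyCharacterSums.lean` (p698468 ✓ f11f4ae4da7b; r6) — the lattice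
  side of SUPPLY made MECHANICAL: transport from a stable pure sublattice `L ⊂ ℤ^n` with any ℤ-basis (`toPermModel`); `L = ker A`, `A = χ_W(1)·Σ_g χ_W(g)·g − #G`
  (`classSumOp ∕ isotypicOp`, equivariant for a class function — `CartanTorusCubeCut.PS.char_conj`; kernels stable and pure, coordinate sums `0` when
  `Σ_g χ_W(g) = 0`, basis by `Submodule.basisOfPid`); the `G`-set = `G ∕ T` (`cosetPerm`, transitive; `[G:T_s] = q(q+1)`, `[G:C(η)] = q(q−1)`, `3 ∤ [G:T]` in the
  right residue class, from `Matrix.card_GL_field` + cartan-f2a's torus orders). Chain of PROVED links: SUPPLY ⟸ `CartanPermModelSupply` ⟸ `CartanPermSubmoduleSupply`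
  ⟸ `CartanIsotypicKernelSupply` ⟸ `CartanCosetSupply`, the last asking per prime `q ≠ 3` ONLY: `Σ_g χ_W(g) = 0`, `tr(g | ker A) = χ_W(g)` on `ℤ[G ∕ T]`
  («`W_q` once in `ℚ[G ∕ T]`»), `η`, the two torus lines of `ker A`; and ⟸ `CartanCosetTraceSupply` (file V), where `Σ_g χ_W(g) = 0` is DROPPED — it follows from the
  trace identity on a transitive lattice (`sum_char_eq_zero_of_trace_eq`: `Σ_g χ(g) = tr(Σ_g g | ker A)` is `0` if `𝟙 ∉ ker A` and `#G` if `𝟙 ∈ ker A`, the latter forcing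
  `χ(1) = 1`; `χ_W(1) = q ± 1 ≠ 1` for `q ≠ 2`; the place `2` is the LEAD's `CartanSignLatticeTwo.cartanTorusLatticeSupply_two`).
  FINALLY ⟸ `CartanTraceIdentitySupply` (file VI, RANK BY TRACE `exists_generator_of_trace`: `ι ∘ Q = Σ_{t∈T₀} t|_K`, `Q ∘ ι = |T₀|·id`,
  `LinearMap.trace_comp_comm'` ⇒ `Σ_{T₀} χ = |T₀|·rank K^{T₀}`; the tree's torus sums `Σ_T χ_W = |T|` make both fixed sublattices LINES, and an elliptic `η` exists for
  `q ≠ 2`): per prime `q ∉ {2,3}` NOTHING BUT the trace identity `tr(g | ker A_{χ_W}) = χ_W(g)` on `ℤ[G ∕ T_s]` (`q ≡ 1 (3)`) ∕ on `ℤ[G ∕ C(η)]` for some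
  elliptic `η` (`q ≡ 2 (3)`).
  AND THAT, character-free and over `ℤ` (files VII–VIII: `trace_eq_of_convolution`, `card_conj_mem_eq_mul_fixed`) ⟸ `CartanCharacterSumSupply`: per prime `q ∉ {2,3}`
  the two finite identities (α) `χ_W(1)·Σ_h χ_W(h)χ_W(h⁻¹k) = N·χ_W(k)` and (β′) `χ_W(1)·Σ_h χ_W(h)·#{y | y⁻¹(gh)y ∈ T} = N·|T|·χ_W(g)` (`T = splitTorus q` ∕ `nonsplitTorus η`),
  sums of `cubicNewvectorChar q` over `GL₂(𝔽_q)` in cartan-f2a's own language.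
* (r7, seat g13) ENGINE IX `…CartanSupplyVirtualCharacter.lean` (p702821 ✓ fc32721d9a47), `…VirtualCharacterSums.lean` (p703317 ✓ c213b7ad98e2), `…VirtualSupply.lean`
  (p704342 ✓ 04b72d6bb35c): over any field of characteristic zero a virtual character `f = χ_A − χ_B` of norm one with `dim B < dim A` is the character of an irreducible
  `U ≤ A` with `End_G U = k` (hom-stripping induction, no Wedderburn), whence (α), (β) and `cartanTorusLatticeSupply_of_virtual : CubicNewvectorCharNormOne →
  CubicNewvectorCharVirtual → CartanTorusLatticeSupply`; and NORM ONE `…CartanSupplyNormOne{Conj,Split,Elliptic,Sum}.lean` (p704213 ✓ 4ef36ca3f29a, p704496 ✓ 5a6dc1de255a,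
  p705315 ✓, p705433 ✓): `NormOne.sum_sq_eq_card : q ≠ 3 → q ≠ 2 → Σ_{g : G q} χ_W(g)² = |G q|` PROVED without class enumeration (conjugacy by `(tr, det)`, fibre formula,
  double count, the split ∕ non-split torus identities, type partition), so `NormOne.cubicNewvectorCharNormOne : CubicNewvectorCharNormOne` and SUPPLY ⟸ the single node
  `CubicNewvectorCharVirtual` («`χ_W = χ_{ρA} − χ_{ρB}` for two finite-dimensional `ℚ`-representations», the LINE OWNER's Hecke eigen-lattice ∕ `Y_s, GG₁, Y_ns`):
  `NormOne.cartanTorusLatticeSupply_of_virtualRealisation`.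
* (r8, seats g13–g14) THE MONOMIAL ROAD — SUPPLY IS A TREE THEOREM: `…CartanSupplyMonomial.lean` (p706374 ✓ 13ac4e4c9f90), `…MonomialCubic.lean` (p706758 ✓ ca1ca94b9d88),
  `…MonomialPS.lean` (p707272 ✓ 6d962b2b315f: `Ind_B^G(χ₃∘(a∕d))` realises `χ_W` at `q ≡ 1 (3)`), `…MonomialCuspZN.lean` (p707488 ✓), `…MonomialCuspTorus.lean` (p708803 ✓),
  `…MonomialNet.lean` (p708995 ✓ 499c8795953a: `χ_W = χ(Ind_{ZN}ψ) − χ(Ind_{T_C}θ)` at `q ≡ 2 (3)`, whence `CartanSupply.Monomial.cartanConvolutionSupply_holds` and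
  **`CartanSupply.Monomial.cartanTorusLatticeSupply_holds : CartanTorusLatticeSupply`** — no hypothesis, axioms {propext, Classical.choice, Quot.sound}; also
  `cartanTorusLatticeSupplyCusp_holds : CubicLattice.CartanTorusLatticeSupplyCusp`). With the LINE OWNER's unconditional S-K1′
  (`Theorems.CartanF2bResidue.cubicTorusPeriodRatioAtThree`, file `…CartanStubF2bResidue.lean`) the registered stub (F2b♭) and the class-minimal one-place law NUM are now
  EQUIVALENT OUTRIGHT (`dictionaryVal_iff_NUM` below), and the line `cartan` (v13) has ONE open stub: NUM `stub_cartanOnePlaceDegreeLawAtThree`. The correspondence road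
  (S3♭ ∧ COR ∧ U♯ ∧ SIGN) survives below only as an index of ALTERNATIVE sufficient inputs for NUM (`dictionaryVal_of_correspondence_supplied`); the LIVE road to NUM is the
  LINE OWNER's Hom-lattice ∕ Ihara reduction (tam3-p1 g24 `NUM-PROOF-SKETCH.md`; cusp places automatic by `CartanSupply.CuspNoFixed.noFixedVectorModThree_of_cusp`, p710975 ✓),
  refereed in `Cruxes/EulerHalvesAtThree/NUM-VETTING.md` (this seat, g14).
Card: `Lines/cartan_corr.md` (r1.11: SUPPLY proved-Lean by the monomial road; r1.10: NORM ONE proved-Lean, SUPPLY ⟸ the single node `CubicNewvectorCharVirtual`; r1.9: permutation formulas for `2χ_W`; r1.8: SUPPLY as pure character sums; r1.7: SUPPLY — everything but the character theory mechanical; r1.6: SUPPLY via permutation models; r1.5: axis law PROVED-LEAN, `R ∩ [1,1000)` decided; r1.4: the elementary proofs — involution `t ↦ D/t`, determinant `ε(D)θ(D)q`, Gauss ∕ Jacobi master formula, sieve). HONEST FRAMING: the stub (F2b♭), NUM, NUM_V, COR, SIGN, U♯, S-K1′ are NOT proved; no summit statement, no route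
item and no registered stub is proved by this line; BSD is proved for no curve.

CLOSE PATHS OFFERED TO THE LEAD (tam3-p1, line `cartan` v9), each a term over closed named inputs (RULING 91(b)):
`stub_cartanHomLatticeDictionaryAtThreeVal := dictionaryVal_of_onePlaceLaw h2a hL hNUM`
  `= cartanHomLatticeDictionaryAtThreeVal_of_correspondence h2a hL hS3 hCOR hU hSIGN`
  `= cartanHomLatticeDictionaryAtThreeVal_of_onePlaceLawVMin h2a hL hS3 hNUMV`, with `hU := cubicTorusPairSum_of_closedForm hI hLaw hCusp` `= cubicTorusPairSum_of_regimes hI hN1 hN2 hN3 hCusp`.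
(line `cartan` v11, r7) `stub_cartanTorusLatticeSupply := NormOne.cartanTorusLatticeSupply_of_virtualRealisation hV`, `hV : CartanSupply.CubicNewvectorCharVirtual` the ONE remaining input.
(line `cartan` v11 ∕ v13, r8) `stub_cartanTorusLatticeSupply := CartanSupply.Monomial.cartanTorusLatticeSupply_holds` (CLOSED, no input); turnkey v12 SUPPLY stub
`:= CartanSupply.Monomial.cartanTorusLatticeSupplyCusp_holds`; `stub_cartanHomLatticeDictionaryAtThreeVal := dictionaryVal_of_NUM_supplied hNUM`, `hNUM : CartanOnePlaceDegreeLawAtThree` the ONE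
remaining input of the whole line.
* (r9, seat g14) WHERE NUM STANDS. NUM (the ONE open stub of 23422's line `cartan` v13) is attacked on the LINE OWNER's Hom-lattice ∕ Ihara road
  (`NUM-PROOF-SKETCH.md`, tam3-p1 g24), refereed SOUND in `Cruxes/EulerHalvesAtThree/NUM-VETTING.md` (6fbfdee53400): NUM ⟸ standard facts (multiplicity one,
  optimal quotients, Rosati, sheet counts, type number one) + S-K1′ (`periodRatio`) + [(𝕃∕3𝕃)^G = 0 for 𝕃 = Hom_ℚ(J(X̄), E₀)]; the last clause is p710975
  (`CuspNoFixed.noFixedVectorModThree_of_cusp`) at cusp places and, at principal-series places, B1 = **p714158 ✓ `CartanSupply.PSNoFixed`** (two subgroups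
  of order prime to 3 + saturation (SAT₃) ⇒ no fixed vector mod 3; index theorem `noFixed_of_unipotentSaturated` below) + B2 = the GEOMETRIC saturation
  (SAT₃) ⟸ Hom_{G_ℚ}(ρ̄, J̄[3]^{PSL₂}) = 0 ⟸ Hochschild–Serre (H^{1,2}(PSL₂(𝔽_q), ℤ∕3) = 0) + purity + CM∕cusp residue fields + good reduction of X_G at q + NOS +
  Serre–Tate (e_q = 3) — a paper argument, NOT a Lean statement. The correspondence road (COR ∕ U♯ ∕ SIGN) is kept only as index theorems of ALTERNATIVE inputs;
  P1♭ ∕ COR♭ are withdrawn (critic V156 (4)). (r10) THE TYPED NODE (FILE B p720153 ✓, `…CartanSaturatedDictionary`): (F2b♮) `CartanHomLatticeSaturatedDictionaryAtThree` = (F2b♭) with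
  its mod-3 clause replaced by (SAT₃) at `q ≡ 1 (3)` and by nothing at `q ≡ 2 (3)`; PROVED (F2b♮) → (F2b♭) → NUM (index theorems `NUM_of_saturatedDictionary`,
  `dictionaryVal_of_saturatedDictionary` below). (r11) THE CONVERSE IS A TREE THEOREM (LINE OWNER tam3-p1 g25, p722297 ✓ `…CartanSatOfNoFixed`:
  `satThree_of_cartanTorusLattice` — at `q ≡ 1 (3)` the mod-3 clause of EVERY Cartan torus lattice implies (SAT₃), by `SL₂`-generation + the (F2a) cube engine
  `PS.rho_cube_comp_normU`; this seat's parallel file C was WITHDRAWN unproposed as a duplicate): (F2b♭) → (F2b♮) and **(F2b♮) ⟺ (F2b♭) ⟺ NUM** outright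
  (`saturatedDictionary_of_dictionaryVal`, `saturatedDictionary_iff_NUM` below) — the v14 node of 23422 `Lines/cartan.lean` asks EXACTLY what the v13 stub NUM asked;
  the residue on this road is the GEOMETRIC dictionary alone. HONEST: NUM, (F2b♮), (F2b♭), 23422, 19109 remain unproved; BSD is proved for no curve.
-/

set_option linter.dupNamespace false
set_option autoImplicit false

namespace Summit.BirchSwinnertonDyer.BirchSwinnertonDyer.Cruxes.EulerHalvesAtThree.CartanCorr

open Summit.BirchSwinnertonDyer.BirchSwinnertonDyer.Theorems.CartanDegree
  Summit.BirchSwinnertonDyer.BirchSwinnertonDyer.Theorems.CartanTorusCubeCut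
  Summit.BirchSwinnertonDyer.BirchSwinnertonDyer.Theorems.CartanCorrespondence
  Summit.BirchSwinnertonDyer.BirchSwinnertonDyer.Theorems.CartanSupply

/-- r2 INDEX — (F2b♭) BY NAME from S-K1′, the lattice supply and the class-minimal one-place law NUM (Cut file). [folklore] -/
theorem dictionaryVal_of_NUM (h2a : CubicTorusPeriodRatioAtThree) (hL : CartanTorusLatticeSupply)
    (hN : CartanOnePlaceDegreeLawAtThree) : CartanHomLatticeDictionaryAtThreeVal :=
  dictionaryVal_of_onePlaceLaw h2a hL hN

/-- r2 INDEX — the converse: (F2b♭) ∧ S-K1′ give NUM back (Cut file). [folklore] -/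
theorem NUM_of_dictionaryVal (h2a : CubicTorusPeriodRatioAtThree) (hD : CartanHomLatticeDictionaryAtThreeVal) :
    CartanOnePlaceDegreeLawAtThree :=
  onePlaceLaw_of_dictionaryVal h2a hD

/-- r2 INDEX — (F2b♭) BY NAME from S-K1′, supply, S3♭ and the correspondence inputs COR, U♯, SIGN (Cut file). [folklore] -/
theorem dictionaryVal_of_correspondence (h2a : CubicTorusPeriodRatioAtThree) (hL : CartanTorusLatticeSupply)
    (hS3 : CartanMinimalDegreeValAtThree) (hC : CartanCorrespondenceDegreeIdentityAtThree) (hU : CubicTorusPairSumAtThree)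
    (hsgn : CartanCorrespondenceSignAtThree) : CartanHomLatticeDictionaryAtThreeVal :=
  cartanHomLatticeDictionaryAtThreeVal_of_correspondence h2a hL hS3 hC hU hsgn

/-- r2 INDEX — tightness, first half: modulo COR ∧ U♯ the orientation SIGN gives the `V`-minimal law NUM_V (Tight file). [folklore] -/
theorem NUMV_of_SIGN (hC : CartanCorrespondenceDegreeIdentityAtThree) (hU : CubicTorusPairSumAtThree)
    (hsgn : CartanCorrespondenceSignAtThree) : CartanOnePlaceDegreeLawVMinAtThree :=
  onePlaceLawVMin_of_correspondence hC hU hsgn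

/-- r2 INDEX — tightness, second half: NUM_V gives SIGN back, so SIGN ⟺ NUM_V modulo COR ∧ U♯ (Tight file). [folklore] -/
theorem SIGN_of_NUMV (hN : CartanOnePlaceDegreeLawVMinAtThree) : CartanCorrespondenceSignAtThree :=
  sign_of_onePlaceLawVMin hN

/-- r2 INDEX — modulo S3♭: NUM → NUM_V (Tight file). [folklore] -/
theorem NUMV_of_NUM (hS3 : CartanMinimalDegreeValAtThree) (hN : CartanOnePlaceDegreeLawAtThree) :
    CartanOnePlaceDegreeLawVMinAtThree :=
  onePlaceLawVMin_of_onePlaceLaw hS3 hN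

/-- r2 INDEX — modulo S3♭: NUM_V → NUM, so the two laws are equivalent (Tight file). [folklore] -/
theorem NUM_of_NUMV (hS3 : CartanMinimalDegreeValAtThree) (hN : CartanOnePlaceDegreeLawVMinAtThree) :
    CartanOnePlaceDegreeLawAtThree :=
  onePlaceLaw_of_onePlaceLawVMin hS3 hN

/-- r2 INDEX — U♯ from its closed form at the PS places, the elementary count law and the cuspidal places (CubicSum file). [folklore] -/
theorem U_of_closedForm (hI : CubicTorusPairSumClosedFormAtThree) (hLaw : CubicClassCountLawAtThree)
    (hCusp : CubicTorusPairSumAtThreeCuspidalPlaces) : CubicTorusPairSumAtThree :=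
  cubicTorusPairSum_of_closedForm hI hLaw hCusp

/-- r2 INDEX — the count law is a THEOREM for every prime `q ≡ 1 (3)` up to `43` (kernel `decide`; CubicSum file). [folklore] -/
theorem countLaw_upTo43 : CubicClassCountLawUpTo43AtThree := cubicClassCountLawUpTo43

/-- r2 INDEX — the full chain: (F2b♭) BY NAME from S-K1′, supply, S3♭, COR, SIGN and the three U♯-pieces. [folklore] -/
theorem dictionaryVal_of_all (h2a : CubicTorusPeriodRatioAtThree) (hL : CartanTorusLatticeSupply)
    (hS3 : CartanMinimalDegreeValAtThree) (hC : CartanCorrespondenceDegreeIdentityAtThree) (hsgn : CartanCorrespondenceSignAtThree)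
    (hI : CubicTorusPairSumClosedFormAtThree) (hLaw : CubicClassCountLawAtThree) (hCusp : CubicTorusPairSumAtThreeCuspidalPlaces) :
    CartanHomLatticeDictionaryAtThreeVal :=
  cartanHomLatticeDictionaryAtThreeVal_of_correspondence h2a hL hS3 hC (cubicTorusPairSum_of_closedForm hI hLaw hCusp) hsgn

/-- r3 INDEX — `3 ∣ |Σ_Q|²` for every irreducible form is a THEOREM (Regimes file: the cubic classes partition `𝔽_q^×`). [folklore] -/
theorem threeDvd_sumNorm : CubicSumNormThreeDvdAtThree := cubicSumNormThreeDvd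

/-- r4 INDEX — the AXIS COUNT LAW is a THEOREM (Axis file: involution `t ↦ D/t`, paired root counts, class counting). [folklore] -/
theorem axisCount : CubicAxisCountAtThree := cubicAxisCount

/-- r4 INDEX — `|Σ_Q|² = 3n²` for every irreducible form is a THEOREM (Axis + Regimes files). [folklore] -/
theorem sumNormAxis : CubicSumNormAxisAtThree := cubicSumNormAxis

/-- r3 INDEX — the count law from its three regimes: `β = 0` family (2 non-cube), sieve (`q ≢ 1 (27)`), residual class `R` (OPEN)
(Regimes file). [folklore] -/
theorem countLaw_of_regimes (hN1 : CubicBetaZeroCountLawAtThree) (hN2 : CubicClassCountLawSieveAtThree)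
    (hN3 : CubicClassCountLawResidualAtThree) : CubicClassCountLawAtThree :=
  cubicClassCountLaw_of_regimes hN1 hN2 hN3

/-- r3 INDEX — the count law is a THEOREM for every prime `q ≡ 1 (3)` up to `157` (Rungs file). [folklore] -/
theorem countLaw_upTo157 : CubicClassCountLawUpTo157AtThree := cubicClassCountLawUpTo157

/-- r3 INDEX — the full chain with U♯ resolved into closed form + regimes + cuspidal places: (F2b♭) BY NAME. [folklore] -/
theorem dictionaryVal_of_all_regimes (h2a : CubicTorusPeriodRatioAtThree) (hL : CartanTorusLatticeSupply)
    (hS3 : CartanMinimalDegreeValAtThree) (hC : CartanCorrespondenceDegreeIdentityAtThree) (hsgn : CartanCorrespondenceSignAtThree)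
    (hI : CubicTorusPairSumClosedFormAtThree) (hN1 : CubicBetaZeroCountLawAtThree) (hN2 : CubicClassCountLawSieveAtThree)
    (hN3 : CubicClassCountLawResidualAtThree) (hCusp : CubicTorusPairSumAtThreeCuspidalPlaces) :
    CartanHomLatticeDictionaryAtThreeVal :=
  cartanHomLatticeDictionaryAtThreeVal_of_correspondence h2a hL hS3 hC (cubicTorusPairSum_of_regimes hI hN1 hN2 hN3 hCusp) hsgn

/-- r5 INDEX — SUPPLY (the v11 stub `CartanTorusLatticeSupply`) BY NAME from permutation-model supply (p692372). [folklore] -/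
theorem supply_of_permModelSupply (h : CartanPermModelSupply) : CartanTorusLatticeSupply :=
  cartanTorusLatticeSupply_of_permModelSupply h

/-- r5 INDEX — (F2b♭) BY NAME with SUPPLY resolved into permutation-model supply. [folklore] -/
theorem dictionaryVal_of_permModelSupply (h2a : CubicTorusPeriodRatioAtThree) (hP : CartanPermModelSupply)
    (hN : CartanOnePlaceDegreeLawAtThree) : CartanHomLatticeDictionaryAtThreeVal :=
  dictionaryVal_of_onePlaceLaw h2a (cartanTorusLatticeSupply_of_permModelSupply hP) hN

/-- r6 INDEX — SUPPLY BY NAME from permutation-SUBMODULE supply (p693435: transport done once). [folklore] -/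
theorem supply_of_permSubmoduleSupply (h : CartanPermSubmoduleSupply) : CartanTorusLatticeSupply :=
  cartanTorusLatticeSupply_of_permSubmoduleSupply h

/-- r6 INDEX — SUPPLY BY NAME from ISOTYPIC-KERNEL supply (p693853: `L = ker A_{χ_W}`). [folklore] -/
theorem supply_of_isotypicKernelSupply (h : CartanIsotypicKernelSupply) : CartanTorusLatticeSupply :=
  cartanTorusLatticeSupply_of_isotypicKernelSupply h

/-- r6 INDEX — SUPPLY BY NAME from COSET supply (the `G`-sets `G ∕ T_s`, `G ∕ C(η)`; character-theoretic content only). [folklore] -/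
theorem supply_of_cosetSupply (h : CartanCosetSupply) : CartanTorusLatticeSupply :=
  cartanTorusLatticeSupply_of_cosetSupply h

/-- r6 INDEX — (F2b♭) BY NAME with SUPPLY resolved into coset supply. [folklore] -/
theorem dictionaryVal_of_cosetSupply (h2a : CubicTorusPeriodRatioAtThree) (hC : CartanCosetSupply)
    (hN : CartanOnePlaceDegreeLawAtThree) : CartanHomLatticeDictionaryAtThreeVal :=
  dictionaryVal_of_onePlaceLaw h2a (cartanTorusLatticeSupply_of_cosetSupply hC) hN

/-- INDEX (r6): SUPPLY ⟸ `CartanCosetTraceSupply` — per prime `q ∉ {2,3}` only the trace identity on `ker A ⊂ ℤ[G ∕ T]`, `η` and the two torus lines. -/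
theorem supply_of_cosetTraceSupply (h : CartanCosetTraceSupply) : CartanTorusLatticeSupply :=
  cartanTorusLatticeSupply_of_cosetTraceSupply h

/-- INDEX (r6): (F2b♭)'s dictionary value from (F2a) + `CartanCosetTraceSupply` + NUM. -/
theorem dictionaryVal_of_cosetTraceSupply (h2a : CubicTorusPeriodRatioAtThree) (hC : CartanCosetTraceSupply)
    (hN : CartanOnePlaceDegreeLawAtThree) : CartanHomLatticeDictionaryAtThreeVal :=
  dictionaryVal_of_onePlaceLaw h2a (cartanTorusLatticeSupply_of_cosetTraceSupply hC) hN

/-- INDEX (r6): SUPPLY ⟸ `CartanTraceIdentitySupply` — per prime `q ∉ {2,3}` NOTHING BUT the trace identity on `ker A_{χ_W} ⊂ ℤ[G ∕ T]`. -/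
theorem supply_of_traceIdentitySupply (h : CartanTraceIdentitySupply) : CartanTorusLatticeSupply :=
  cartanTorusLatticeSupply_of_traceIdentitySupply h

/-- INDEX (r6): (F2b♭)'s dictionary value from (F2a) + `CartanTraceIdentitySupply` + NUM. -/
theorem dictionaryVal_of_traceIdentitySupply (h2a : CubicTorusPeriodRatioAtThree) (hT : CartanTraceIdentitySupply)
    (hN : CartanOnePlaceDegreeLawAtThree) : CartanHomLatticeDictionaryAtThreeVal :=
  dictionaryVal_of_onePlaceLaw h2a (cartanTorusLatticeSupply_of_traceIdentitySupply hT) hN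

/-- INDEX (r6): SUPPLY ⟸ `CartanConvolutionSupply` — (α) + (β) (fixed-point form), over `ℤ`. -/
theorem supply_of_convolutionSupply (h : CartanConvolutionSupply) : CartanTorusLatticeSupply :=
  cartanTorusLatticeSupply_of_convolutionSupply h

/-- INDEX (r6): SUPPLY ⟸ `CartanCharacterSumSupply` — (α) + (β′), pure sums of `cubicNewvectorChar q` over `GL₂(𝔽_q)` and the tree's tori (superseded as the net input by r7's `supply_of_virtualRealisation`). -/
theorem supply_of_characterSumSupply (h : CartanCharacterSumSupply) : CartanTorusLatticeSupply :=
  cartanTorusLatticeSupply_of_characterSumSupply h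

/-- INDEX (r6): (F2b♭)'s dictionary value from (F2a) + `CartanCharacterSumSupply` + NUM. -/
theorem dictionaryVal_of_characterSumSupply (h2a : CubicTorusPeriodRatioAtThree) (hS : CartanCharacterSumSupply)
    (hN : CartanOnePlaceDegreeLawAtThree) : CartanHomLatticeDictionaryAtThreeVal :=
  dictionaryVal_of_onePlaceLaw h2a (cartanTorusLatticeSupply_of_characterSumSupply hS) hN

/-! ## r7 — NORM ONE PROVED; SUPPLY ⟸ the single node `CubicNewvectorCharVirtual` -/

/-- INDEX (r7): NORM ONE `Σ_g χ_W(g)² = |GL₂(𝔽_q)|` for every prime `q ∉ {2,3}` — PROVED (`NormOne.sum_sq_eq_card`). -/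
theorem normOne : CubicNewvectorCharNormOne := NormOne.cubicNewvectorCharNormOne

/-- INDEX (r7): SUPPLY ⟸ NORM ONE + VIRTUAL REALISATION (engine IX, `cartanTorusLatticeSupply_of_virtual`). -/
theorem supply_of_virtual (hN : CubicNewvectorCharNormOne) (hV : CubicNewvectorCharVirtual) : CartanTorusLatticeSupply :=
  cartanTorusLatticeSupply_of_virtual hN hV

/-- INDEX (r7): SUPPLY ⟸ VIRTUAL REALISATION alone — THE NET REMAINING INPUT of the v11 stub SUPPLY. -/
theorem supply_of_virtualRealisation (hV : CubicNewvectorCharVirtual) : CartanTorusLatticeSupply :=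
  NormOne.cartanTorusLatticeSupply_of_virtualRealisation hV

/-- INDEX (r7): (F2b♭)'s dictionary value from (F2a) + VIRTUAL REALISATION + NUM. -/
theorem dictionaryVal_of_virtualRealisation (h2a : CubicTorusPeriodRatioAtThree) (hV : CubicNewvectorCharVirtual)
    (hN : CartanOnePlaceDegreeLawAtThree) : CartanHomLatticeDictionaryAtThreeVal :=
  dictionaryVal_of_onePlaceLaw h2a (NormOne.cartanTorusLatticeSupply_of_virtualRealisation hV) hN

/-! ## r8 — SUPPLY PROVED (the monomial road, p706374 … p708995 ✓); (F2b♭) ⟺ NUM OUTRIGHT -/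

/-- INDEX (r8): SUPPLY — the v11 ∕ v13 stub `CartanTorusLatticeSupply` — is a THEOREM (monomial road, `CartanSupply.Monomial.cartanTorusLatticeSupply_holds`). [folklore] -/
theorem supply : CartanTorusLatticeSupply := Monomial.cartanTorusLatticeSupply_holds

/-- INDEX (r8): the turnkey (v12) form of SUPPLY over the cubic-lattice vocabulary is a THEOREM (`CartanSupply.Monomial.cartanTorusLatticeSupplyCusp_holds`). [folklore] -/
theorem supplyCusp : CubicLattice.CartanTorusLatticeSupplyCusp := Monomial.cartanTorusLatticeSupplyCusp_holds

/-- INDEX (r8): (α) + (β) over `ℤ` for every prime `q ∉ {2,3}` is a THEOREM (`CartanSupply.Monomial.cartanConvolutionSupply_holds`). [folklore] -/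
theorem convolutionSupply : CartanConvolutionSupply := Monomial.cartanConvolutionSupply_holds

/-- INDEX (r8): S-K1′ for every prime `q ≠ 3` — the LINE OWNER's unconditional theorem (`Theorems.CartanF2bResidue.cubicTorusPeriodRatioAtThree`, tam3-p1). [folklore] -/
theorem periodRatio : CubicTorusPeriodRatioAtThree := Theorems.CartanF2bResidue.cubicTorusPeriodRatioAtThree

/-- INDEX (r8): the registered stub (F2b♭) BY NAME from NUM ALONE (S-K1′ and SUPPLY discharged). [folklore] -/
theorem dictionaryVal_of_NUM_supplied (hN : CartanOnePlaceDegreeLawAtThree) : CartanHomLatticeDictionaryAtThreeVal :=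
  dictionaryVal_of_onePlaceLaw Theorems.CartanF2bResidue.cubicTorusPeriodRatioAtThree Monomial.cartanTorusLatticeSupply_holds hN

/-- INDEX (r8): (F2b♭) ⟺ NUM with NO side input (`CartanF2bResidue.dictionaryVal_iff_onePlaceLaw` at the proved SUPPLY). [folklore] -/
theorem dictionaryVal_iff_NUM : CartanHomLatticeDictionaryAtThreeVal ↔ CartanOnePlaceDegreeLawAtThree :=
  Theorems.CartanF2bResidue.dictionaryVal_iff_onePlaceLaw Monomial.cartanTorusLatticeSupply_holds

/-- INDEX (r8): the correspondence road with S-K1′ and SUPPLY discharged — (F2b♭) from S3♭ ∧ COR ∧ U♯ ∧ SIGN (kept as an index of ALTERNATIVE sufficient inputs; not the live road). [folklore] -/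
theorem dictionaryVal_of_correspondence_supplied (hS3 : CartanMinimalDegreeValAtThree) (hC : CartanCorrespondenceDegreeIdentityAtThree)
    (hU : CubicTorusPairSumAtThree) (hsgn : CartanCorrespondenceSignAtThree) : CartanHomLatticeDictionaryAtThreeVal :=
  cartanHomLatticeDictionaryAtThreeVal_of_correspondence Theorems.CartanF2bResidue.cubicTorusPeriodRatioAtThree Monomial.cartanTorusLatticeSupply_holds hS3 hC hU hsgn

/-- INDEX (r8): NUM from S3♭ ∧ COR ∧ U♯ ∧ SIGN (the correspondence road read as a sufficient condition for the ONE open stub). [folklore] -/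
theorem NUM_of_correspondence_supplied (hS3 : CartanMinimalDegreeValAtThree) (hC : CartanCorrespondenceDegreeIdentityAtThree)
    (hU : CubicTorusPairSumAtThree) (hsgn : CartanCorrespondenceSignAtThree) : CartanOnePlaceDegreeLawAtThree :=
  dictionaryVal_iff_NUM.mp (dictionaryVal_of_correspondence_supplied hS3 hC hU hsgn)

/-! ## r6 — TYPED TARGETS (statement only, numerically verified, hand-proved class by class in the card r1.9; NOT kernel-checked):
`χ_W` is half a difference of PERMUTATION CHARACTERS. Conjugation-count form (`#{y | y⁻¹my ∈ H} = |H|·π[G∕H](m)`), in the tree's language. -/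

/-- PERMUTATION FORMULA at `q ≡ 1 (3)`: `2·|B|·χ_W(m) = 3·#{y | y⁻¹my ∈ B₃} − #{y | y⁻¹my ∈ B}`, `B` the upper-triangular Borel (`|B| = q(q−1)²`),
`B₃ = {b ∈ B : (b₀₀∕b₁₁)^{(q−1)∕3} = 1}`; i.e. `2χ_W = π[G∕B₃] − π[G∕B]`. Verified on all of `GL₂(𝔽_q)` for `q ∈ {7, 13 (sampled)}`. -/
@[conjecture]
def PermFormulaPS : Prop := ∀ (q : ℕ) [Fact q.Prime], q % 3 = 1 → ∀ m : GL (Fin 2) (ZMod q),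
  2 * (q : ℤ) * ((q : ℤ) - 1) ^ 2 * cubicNewvectorChar q m =
    3 * ((Finset.univ.filter fun y : GL (Fin 2) (ZMod q) =>
          ((y⁻¹ * m * y : GL (Fin 2) (ZMod q)) : Matrix (Fin 2) (Fin 2) (ZMod q)) 1 0 = 0 ∧
          (((y⁻¹ * m * y : GL (Fin 2) (ZMod q)) : Matrix (Fin 2) (Fin 2) (ZMod q)) 0 0 *
            (((y⁻¹ * m * y : GL (Fin 2) (ZMod q)) : Matrix (Fin 2) (Fin 2) (ZMod q)) 1 1)⁻¹) ^ ((q - 1) / 3) = 1).card : ℤ) -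
      ((Finset.univ.filter fun y : GL (Fin 2) (ZMod q) =>
          ((y⁻¹ * m * y : GL (Fin 2) (ZMod q)) : Matrix (Fin 2) (Fin 2) (ZMod q)) 1 0 = 0).card : ℤ)

/-- PERMUTATION FORMULA at `q ≡ 2 (3)`: for every elliptic `η`,
`2q(q−1)²(q+1)·χ_W(m) = 3q(q−1)·(#{y | y⁻¹my ∈ T_C} − #{y | y⁻¹my ∈ T_{C,3}}) + 2(q+1)·#{y | y⁻¹my ∈ B} − 4q(q−1)²(q+1)`, `T_C = nonsplitTorus η`,
`T_{C,3} = {t ∈ T_C : t^{(q²−1)∕3} = 1}`; i.e. `2χ_W = 3π[G∕T_C] − π[G∕T_{C,3}] + 2π[G∕B] − 4`. Verified on all of `GL₂(𝔽_q)` for `q ∈ {5, 11}`. -/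
@[conjecture]
def PermFormulaCusp : Prop := ∀ (q : ℕ) [Fact q.Prime], q % 3 = 2 → ∀ η : Matrix (Fin 2) (Fin 2) (ZMod q), ¬ HasRatEigenvalue η →
  ∀ m : GL (Fin 2) (ZMod q),
  2 * (q : ℤ) * ((q : ℤ) - 1) ^ 2 * ((q : ℤ) + 1) * cubicNewvectorChar q m =
    3 * (q : ℤ) * ((q : ℤ) - 1) *
      (((Finset.univ.filter fun y : GL (Fin 2) (ZMod q) => y⁻¹ * m * y ∈ nonsplitTorus η).card : ℤ) -
       ((Finset.univ.filter fun y : GL (Fin 2) (ZMod q) => y⁻¹ * m * y ∈ nonsplitTorus η ∧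
          (((y⁻¹ * m * y : GL (Fin 2) (ZMod q)) : Matrix (Fin 2) (Fin 2) (ZMod q)) ^ ((q ^ 2 - 1) / 3) = 1)).card : ℤ)) +
    2 * ((q : ℤ) + 1) * ((Finset.univ.filter fun y : GL (Fin 2) (ZMod q) =>
          ((y⁻¹ * m * y : GL (Fin 2) (ZMod q)) : Matrix (Fin 2) (Fin 2) (ZMod q)) 1 0 = 0).card : ℤ) -
    4 * (q : ℤ) * ((q : ℤ) - 1) ^ 2 * ((q : ℤ) + 1)

/-! ## r9 — the finite-group half of NUM's principal-series clause is a tree theorem (p714158) -/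

/-- index (r9): B1 of `NUM-VETTING.md` BY NAME at `ℓ = 3` with the unipotent pair `(1 1; 0 1)`, `(1 0; 1 1)` — for a prime `q ≠ 3`, (SAT₃) for the two
unipotent fixed lattices implies the `noFixedVectorModThree` clause of `CartanDegree.CartanTorusLattice` for ANY `ℤ`-representation of `GL₂(𝔽_q)`
(`CartanSupply.PSNoFixed.noFixedVectorModThree_of_unipotentSaturated'`; the generic two-subgroup form is `CartanSupply.PSNoFixed.noFixedVectorMod_of_pair`). [folklore] -/
theorem noFixed_of_unipotentSaturated {q : ℕ} [Fact q.Prime] (hq3 : q ≠ 3) {d : ℕ} (ρ : Representation ℤ (G q) (Fin d → ℤ))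
    (hsat : ∀ uU uL : G q, ((uU : G q) : Mat q) = !![1, 1; 0, 1] → ((uL : G q) : Mat q) = !![1, 0; 1, 1] →
      ∀ a₁ a₂ : Fin d → ℤ, ρ uU a₁ = a₁ → ρ uL a₂ = a₂ →
      (∃ w : Fin d → ℤ, a₁ + a₂ = (3 : ℤ) • w) → ∃ w : Fin d → ℤ, a₁ = (3 : ℤ) • w)
    (v : Fin d → ℤ) (hv : ∀ g, ∃ w : Fin d → ℤ, ρ g v - v = (3 : ℤ) • w) : ∃ w : Fin d → ℤ, v = (3 : ℤ) • w :=
  Theorems.CartanSupply.PSNoFixed.noFixedVectorModThree_of_unipotentSaturated' hq3 ρ hsat v hv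

/-- index (r10): PROVED (F2b♮) → (F2b♭) (`CartanSaturatedDictionary.dictionaryVal_of_saturatedDictionary`). [folklore] -/
theorem dictionaryVal_of_saturatedDictionary
    (h : Theorems.CartanSaturatedDictionary.CartanHomLatticeSaturatedDictionaryAtThree) : CartanHomLatticeDictionaryAtThreeVal :=
  Theorems.CartanSaturatedDictionary.dictionaryVal_of_saturatedDictionary h

/-- index (r10): PROVED (F2b♮) → NUM (`CartanSaturatedDictionary.onePlaceLaw_of_saturatedDictionary`): the open surface of NUM on the Hom-lattice road is (F2b♮) —
standard facts about `Hom(J_X̄, E₀)` plus (SAT₃) at principal-series places (NUM-VETTING §B2, paper proof, refereed V159). [folklore] -/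
theorem NUM_of_saturatedDictionary
    (h : Theorems.CartanSaturatedDictionary.CartanHomLatticeSaturatedDictionaryAtThree) : CartanOnePlaceDegreeLawAtThree :=
  Theorems.CartanSaturatedDictionary.onePlaceLaw_of_saturatedDictionary h

/-! ## r11 — the converse is a tree theorem (LINE OWNER tam3-p1 g25, p722297): (F2b♮) ⟺ (F2b♭) ⟺ NUM -/

/-- index (r11): PROVED (F2b♭) → (F2b♮) (`CartanSatOfNoFixed.saturatedDictionary_of_dictionaryVal`, from `CartanSatOfNoFixed.satThree_of_cartanTorusLattice`:
at `q ≡ 1 (3)` the mod-3 clause implies (SAT₃)). [folklore] -/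
theorem saturatedDictionary_of_dictionaryVal (h : CartanHomLatticeDictionaryAtThreeVal) :
    Theorems.CartanSaturatedDictionary.CartanHomLatticeSaturatedDictionaryAtThree :=
  Theorems.CartanSatOfNoFixed.saturatedDictionary_of_dictionaryVal h

/-- index (r11): **(F2b♮) ⟺ NUM** outright (`CartanSatOfNoFixed.saturatedDictionary_iff_onePlaceLaw`) — the v14 node asks exactly what the v13 stub asked;
with `dictionaryVal_iff_NUM` (r8) all three of (F2b♮), (F2b♭), NUM are equivalent kernel-side. [folklore] -/
theorem saturatedDictionary_iff_NUM :
    Theorems.CartanSaturatedDictionary.CartanHomLatticeSaturatedDictionaryAtThree ↔ CartanOnePlaceDegreeLawAtThree :=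
  Theorems.CartanSatOfNoFixed.saturatedDictionary_iff_onePlaceLaw

end Summit.BirchSwinnertonDyer.BirchSwinnertonDyer.Cruxes.EulerHalvesAtThree.CartanCorr
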